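import Literature.NumberTheory.EllipticCurves.QuadraticTwistLocalPolynomialTwoProofs
import Literature.NumberTheory.EllipticCurves.LFunctionPrimeCoeff
import HarnessLib

/-!
# `L(E^{(p*)}, s) = L(E ⊗ χ_p, s)`: the Dirichlet coefficients of the quadratic twist by `p*`

For an elliptic curve `E / ℚ`, an odd prime `p` and `p* = (−1)^{(p−1)/2} p` (so that `ℚ(√p*)` is
ramified only at `p` and its quadratic character is the Legendre symbol `χ_p = (·/p)`), the quadratic
twist `E' = E^{(p*)}` (the tree's `WeierstrassCurve.quadraticTwist`) satisfies, for Mathlib's formal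
Dirichlet series `WeierstrassCurve.LFunction`,

`aₙ(E') = χ_p(n) aₙ(E)` for every `n` prime to `p` (`WeierstrassCurve.LFunction_quadraticTwist_pStar_apply`).

This is the classical "`L(E ⊗ χ, s) = ∑ χ(n) aₙ n^{-s}` away from the conductor of `χ`"
(Silverman, *AEC* X.2, X.5, Exercise 10.16; Knapp, *Elliptic Curves*, Prop. 12.10), here as an
identity of Euler products, place by place:

* at an odd place `v ∤ p` (prime `q`): `p*` is a `v`-adic unit and
  `L_v(E', T) = L_v(E, χ_p(q) T)` (`localEulerFactor_quadraticTwist` of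
  `QuadraticTwistLocalPolynomialProofs`, with `(p*/q) = (q/p)` by quadratic reciprocity —
  `legendreSym_pStar`);
* at the place over `2`: `p* = 1 + 4c` and `L_2(E', T) = L_2(E, χ_p(2) T)`
  (`localEulerFactor_quadraticTwist_two` of `QuadraticTwistLocalPolynomialTwoProofs`, the sign being
  `+` iff `8 ∣ p* − 1` iff `(2/p) = 1` — `eight_dvd_pStar_sub_one_iff`);
* at `v = p` both local factors are supported on powers of `p`, invisible at `n` prime to `p`;
* `ArithmeticFunction.eulerProduct_apply_eq_mul_of_forall`: an Euler product of arithmetic functions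
  whose factors agree after twisting by a completely multiplicative `ε` on a divisor-closed set of
  `n` is the `ε`-twist there (finite products by the Dirichlet convolution formula, then Mathlib's
  `tendsTo_eulerProduct_of_tendsTo`).

Everything is proved; no definitions and no named facts. It is the elliptic-curve-side input of the
computation of the Atkin–Lehner eigenvalue of the newform of `E` at a prime of quadratic-twist type
(`RootNumberTwistProofs`).

## References

* J. H. Silverman, *The Arithmetic of Elliptic Curves*, 2nd ed. 2009, X.2 Prop. 2.4, X.5 Cor. 5.4,
  Exercise 10.16, App. C §16.
* A. W. Knapp, *Elliptic Curves*, 1993, Prop. 12.10.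
-/

noncomputable section

open scoped Classical

/-! ### Twisting Euler products by a completely multiplicative function -/

namespace ArithmeticFunction

variable {ι R : Type*} [CommRing R]

/-- If `f n = ε n * g n` and `f' n = ε n * g' n` for all `n` in a divisor-closed set `P`, with `ε`
multiplicative on products, then the same holds for the Dirichlet convolutions `f * f'`, `g * g'`.
[folklore] -/
theorem mul_apply_eq_mul_of_forall {P : ℕ → Prop} (hP : ∀ m n, P (m * n) → P m ∧ P n) (ε : ℕ → R)
    (hε : ∀ m n, ε (m * n) = ε m * ε n) {f g f' g' : ArithmeticFunction R}
    (h : ∀ n, P n → f n = ε n * g n) (h' : ∀ n, P n → f' n = ε n * g' n) {n : ℕ} (hn : P n) :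
    (f * f') n = ε n * (g * g') n := by
  rw [mul_apply, mul_apply, Finset.mul_sum]
  refine Finset.sum_congr rfl fun x hx ↦ ?_
  have hxn : x.1 * x.2 = n := (Nat.mem_divisorsAntidiagonal.mp hx).1
  obtain ⟨h1, h2⟩ := hP x.1 x.2 (hxn ▸ hn)
  rw [h x.1 h1, h' x.2 h2, ← hxn, hε]
  ring

/-- Finite products: if each `f i` is the `ε`-twist of `g i` on a divisor-closed set `P` (`ε`
completely multiplicative with `ε 1 = 1`), so is `∏ f i` of `∏ g i`. [folklore] -/
theorem finsetProd_apply_eq_mul_of_forall {P : ℕ → Prop} (hP : ∀ m n, P (m * n) → P m ∧ P n)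
    (ε : ℕ → R) (hε1 : ε 1 = 1) (hε : ∀ m n, ε (m * n) = ε m * ε n) (f g : ι → ArithmeticFunction R)
    (h : ∀ i n, P n → f i n = ε n * g i n) (s : Finset ι) {n : ℕ} (hn : P n) :
    (∏ i ∈ s, f i) n = ε n * (∏ i ∈ s, g i) n := by
  induction s using Finset.induction_on generalizing n with
  | empty =>
    simp only [Finset.prod_empty, one_apply]
    split_ifs with h1
    · rw [h1, hε1, mul_one]
    · rw [mul_zero]
  | insert i s hi ih =>
    rw [Finset.prod_insert hi, Finset.prod_insert hi]
    exact mul_apply_eq_mul_of_forall hP ε hε (h i) (fun m hm ↦ ih hm) hn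

/-- **Twisting an Euler product**: if each factor `f i` agrees with the `ε`-twist of `g i` on a
divisor-closed set `P` of arguments (`ε` completely multiplicative, `ε 1 = 1`) and both families are
eventually `1` in each coefficient, then `eulerProduct f n = ε n · eulerProduct g n` for `n ∈ P`
(pass to the limit in Mathlib's `tendsTo_eulerProduct_of_tendsTo`). [folklore] -/
theorem eulerProduct_apply_eq_mul_of_forall {P : ℕ → Prop} (hP : ∀ m n, P (m * n) → P m ∧ P n)
    (ε : ℕ → R) (hε1 : ε 1 = 1) (hε : ∀ m n, ε (m * n) = ε m * ε n) (f g : ι → ArithmeticFunction R)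
    (h : ∀ i n, P n → f i n = ε n * g i n)
    (hf : ∀ n, ∀ᶠ i in Filter.cofinite, f i n = (1 : ArithmeticFunction R) n)
    (hg : ∀ n, ∀ᶠ i in Filter.cofinite, g i n = (1 : ArithmeticFunction R) n) {n : ℕ} (hn : P n) :
    eulerProduct f n = ε n * eulerProduct g n := by
  have h1 := tendsTo_eulerProduct_of_tendsTo f hf n
  have h2 := tendsTo_eulerProduct_of_tendsTo g hg n
  obtain ⟨s, hs1, hs2⟩ := (h1.and h2).exists
  rw [← hs1, ← hs2]
  exact finsetProd_apply_eq_mul_of_forall hP ε hε1 hε f g h s hn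

/-- An arithmetic function `φ(q^{-s})` supported on powers of `q` and its rescaling by `ε q` agree
after twisting by a multiplicative `ε` (`ε (q^k) = (ε q)^k`): the local form of twisting.
[folklore] -/
theorem ofPowerSeries_rescale_apply {q : ℕ} (hq : 1 < q) (ε : ℕ → R) (hε1 : ε 1 = 1)
    (hε : ∀ m n, ε (m * n) = ε m * ε n) (φ : PowerSeries R) (n : ℕ) :
    ofPowerSeries q (PowerSeries.rescale (ε q) φ) n = ε n * ofPowerSeries q φ n := by
  by_cases hn : ∃ k, q ^ k = n
  · obtain ⟨k, rfl⟩ := hn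
    rw [ofPowerSeries_apply_pow hq, ofPowerSeries_apply_pow hq, PowerSeries.coeff_rescale]
    congr 1
    induction k with
    | zero => rw [pow_zero, pow_zero, hε1]
    | succ k ih => rw [pow_succ, pow_succ, hε, ih]
  · rw [ofPowerSeries_apply hq, ofPowerSeries_apply hq, Function.extend_apply' _ _ _ hn,
      Function.extend_apply' _ _ _ hn, Pi.zero_apply, mul_zero]

end ArithmeticFunction

/-! ### `p* = (−1)^{(p−1)/2} p` and the Legendre symbol `(·/p)` -/

namespace WeierstrassCurve

section PStar

variable {p q : ℕ} [Fact p.Prime] [Fact q.Prime]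

/-- **`(p*/q) = (q/p)`** for distinct odd primes `p, q` (quadratic reciprocity with the first
supplement: `p* = (−1)^{(p−1)/2} p`). [folklore] -/
theorem legendreSym_pStar (hp2 : p ≠ 2) (hq2 : q ≠ 2) :
    legendreSym q ((-1 : ℤ) ^ (p / 2) * p) = legendreSym p q := by
  have hp' := (Nat.Prime.eq_two_or_odd (Fact.out : p.Prime)).resolve_left hp2
  have hq' := (Nat.Prime.eq_two_or_odd (Fact.out : q.Prime)).resolve_left hq2
  rcases Nat.odd_mod_four_iff.mp hp' with hp4 | hp4
  · rw [ZMod.neg_one_pow_div_two_of_one_mod_four hp4, one_mul,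
      legendreSym.quadratic_reciprocity_one_mod_four hp4 hq2]
  · rw [ZMod.neg_one_pow_div_two_of_three_mod_four hp4, legendreSym.mul, legendreSym.at_neg_one hq2]
    rcases Nat.odd_mod_four_iff.mp hq' with hq4 | hq4
    · rw [ZMod.χ₄_nat_one_mod_four hq4, one_mul,
        legendreSym.quadratic_reciprocity_one_mod_four hq4 hp2]
    · rw [ZMod.χ₄_nat_three_mod_four hq4, legendreSym.quadratic_reciprocity_three_mod_four hp4 hq4]
      ring

/-- `p* ≡ 1 (mod 4)`. [folklore] -/
theorem four_dvd_pStar_sub_one (hp2 : p ≠ 2) : (4 : ℤ) ∣ (-1 : ℤ) ^ (p / 2) * p - 1 := by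
  have hp' := (Nat.Prime.eq_two_or_odd (Fact.out : p.Prime)).resolve_left hp2
  rcases Nat.odd_mod_four_iff.mp hp' with hp4 | hp4
  · rw [ZMod.neg_one_pow_div_two_of_one_mod_four hp4, one_mul]
    omega
  · rw [ZMod.neg_one_pow_div_two_of_three_mod_four hp4, neg_one_mul]
    omega

/-- **`8 ∣ p* − 1 ↔ (2/p) = 1`** (second supplement: `(2/p) = 1` iff `p ≡ ±1 (mod 8)`, and
`p* ≡ 1 (mod 8)` iff `p ≡ 1, 7 (mod 8)`). [folklore] -/
theorem eight_dvd_pStar_sub_one_iff (hp2 : p ≠ 2) :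
    (8 : ℤ) ∣ (-1 : ℤ) ^ (p / 2) * p - 1 ↔ legendreSym p 2 = 1 := by
  have hp' := (Nat.Prime.eq_two_or_odd (Fact.out : p.Prime)).resolve_left hp2
  rw [legendreSym.at_two hp2, ZMod.χ₈_nat_eq_if_mod_eight, if_neg (by omega)]
  rcases Nat.odd_mod_four_iff.mp hp' with hp4 | hp4
  · rw [ZMod.neg_one_pow_div_two_of_one_mod_four hp4, one_mul]
    split_ifs with h8 <;> constructor <;> intro h <;> first | omega | exact absurd h (by norm_num)
  · rw [ZMod.neg_one_pow_div_two_of_three_mod_four hp4, neg_one_mul]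
    split_ifs with h8 <;> constructor <;> intro h <;> first | omega | exact absurd h (by norm_num)

end PStar

end WeierstrassCurve

/-! ### The local Euler factors of `E^{(p*)}` -/

namespace WeierstrassCurve

open IsDedekindDomain IsDedekindDomain.HeightOneSpectrum NumberField Rat.HeightOneSpectrum IsLocalRing

variable (W : WeierstrassCurve ℚ) [W.IsElliptic] {p : ℕ} [Fact p.Prime]

/-- `IsSquare` is invariant under ring isomorphisms. [folklore] -/
theorem isSquare_ringEquiv_iff {A B : Type*} [Mul A] [Mul B] (e : A ≃* B) (x : A) :
    IsSquare (e x) ↔ IsSquare x := by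
  refine ⟨fun ⟨r, hr⟩ ↦ ⟨e.symm r, e.injective ?_⟩, fun ⟨r, hr⟩ ↦ ⟨e r, by rw [hr, map_mul]⟩⟩
  rw [map_mul, e.apply_symm_apply, ← hr]

/-- The valuation at `v` of an integer divisible by the prime under `v` is `< 1`. [folklore] -/
theorem valuation_ringOfIntegers_intCast_lt_one (v : HeightOneSpectrum (𝓞 ℚ)) {n : ℤ}
    (hn : ((primesEquiv v : ℕ) : ℤ) ∣ n) : v.valuation ℚ (n : ℚ) < 1 := by
  haveI := Fact.mk (primesEquiv v).2
  rw [(valuation_equiv_padicValuation v).lt_one_iff_lt_one, Rat.padicValuation_cast,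
    Int.padicValuation_lt_one_iff]
  exact hn

/-- The residue field of `O_v` (`v` a finite place of `ℚ` over the prime `ℓ`) is `ℤ/ℓ`, compatibly
with the reduction of integers. [folklore] -/
theorem exists_residueField_ringEquiv_zmod (v : HeightOneSpectrum (𝓞 ℚ)) :
    ∃ e : ResidueField (v.adicCompletionIntegers ℚ) ≃+* ZMod (primesEquiv v : ℕ),
      ∀ n : ℤ, e (residue _ (n : v.adicCompletionIntegers ℚ)) = (n : ZMod (primesEquiv v : ℕ)) := by
  haveI := Fact.mk (primesEquiv v).2
  refine ⟨(IsLocalRing.ResidueField.mapEquiv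
    (adicCompletionIntegers.padicIntEquiv v).toAlgEquiv.toRingEquiv).trans PadicInt.residueField, fun n ↦ ?_⟩
  have h := RingHom.ext_int ((((IsLocalRing.ResidueField.mapEquiv
    (adicCompletionIntegers.padicIntEquiv v).toAlgEquiv.toRingEquiv).trans PadicInt.residueField :
      ResidueField (v.adicCompletionIntegers ℚ) ≃+* ZMod (primesEquiv v : ℕ)) :
      ResidueField (v.adicCompletionIntegers ℚ) →+* ZMod (primesEquiv v : ℕ)).comp
    ((residue (v.adicCompletionIntegers ℚ)).comp (Int.castRingHom _))) (Int.castRingHom _)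
  exact (RingHom.congr_fun h n).trans (by simp)

/-- The image in `K_v` of an integer, through `O_v`, is its image through `ℚ`. [folklore] -/
theorem algebraMap_adicCompletionIntegers_intCast (v : HeightOneSpectrum (𝓞 ℚ)) (n : ℤ) :
    algebraMap (v.adicCompletionIntegers ℚ) (v.adicCompletion ℚ) (n : v.adicCompletionIntegers ℚ) =
      algebraMap ℚ (v.adicCompletion ℚ) (n : ℚ) := by
  rw [map_intCast, map_intCast]

/-- An integer prime to the prime under `v` is a unit of `O_v`. [folklore] -/
theorem isUnit_adicCompletionIntegers_intCast (v : HeightOneSpectrum (𝓞 ℚ)) {n : ℤ}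
    (hn : ¬ ((primesEquiv v : ℕ) : ℤ) ∣ n) : IsUnit (n : v.adicCompletionIntegers ℚ) := by
  rw [adicCompletionIntegers.isUnit_iff_valued_eq_one,
    show ((n : v.adicCompletionIntegers ℚ) : v.adicCompletion ℚ) = algebraMap ℚ (v.adicCompletion ℚ) (n : ℚ)
      from algebraMap_adicCompletionIntegers_intCast v n, valued_algebraMap,
    valuation_ringOfIntegers_intCast_eq_one v hn]

/-- An integer divisible by the prime under `v` reduces to `0` in the residue field of `O_v`.
[folklore] -/
theorem residue_adicCompletionIntegers_intCast_eq_zero (v : HeightOneSpectrum (𝓞 ℚ)) {n : ℤ}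
    (hn : ((primesEquiv v : ℕ) : ℤ) ∣ n) : residue _ (n : v.adicCompletionIntegers ℚ) = 0 := by
  rw [residue_eq_zero_iff, IsLocalRing.mem_maximalIdeal, mem_nonunits_iff,
    adicCompletionIntegers.isUnit_iff_valued_eq_one,
    show ((n : v.adicCompletionIntegers ℚ) : v.adicCompletion ℚ) = algebraMap ℚ (v.adicCompletion ℚ) (n : ℚ)
      from algebraMap_adicCompletionIntegers_intCast v n, valued_algebraMap]
  exact (valuation_ringOfIntegers_intCast_lt_one v hn).ne

/-- **The local factor of `E^{(p*)}` at an odd place `v ∤ p`** (prime `ℓ`): it is the rescaling by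
`(ℓ/p)` of that of `E` — `p*` is an `ℓ`-adic unit, square mod `ℓ` iff `(p*/ℓ) = (ℓ/p) = 1`
(`localEulerFactor_quadraticTwist`, `legendreSym_pStar`). [folklore] -/
theorem localEulerFactor_quadraticTwist_pStar_of_odd (hp2 : p ≠ 2) (v : HeightOneSpectrum (𝓞 ℚ))
    (hv2 : (primesEquiv v : ℕ) ≠ 2) (hvp : (primesEquiv v : ℕ) ≠ p) :
    ((W.quadraticTwist (((-1 : ℤ) ^ (p / 2) * p : ℤ) : ℚ)).baseChange (v.adicCompletion ℚ)).localEulerFactor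
        (v.adicCompletionIntegers ℚ) =
      ArithmeticFunction.ofPowerSeries (primesEquiv v : ℕ)
        (PowerSeries.rescale (legendreSym p (primesEquiv v : ℕ))
          ((W.baseChange (v.adicCompletion ℚ)).localPowerSeries (v.adicCompletionIntegers ℚ))) := by
  haveI := Fact.mk (primesEquiv v).2
  haveI : NeZero (2 : v.adicCompletion ℚ) := ⟨by
    rw [← map_ofNat (algebraMap ℚ (v.adicCompletion ℚ)) 2]; exact (map_ne_zero _).mpr two_ne_zero⟩
  haveI : (W.baseChange (v.adicCompletion ℚ)).IsElliptic := by
    change (W.map _).IsElliptic; infer_instance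
  set d : ℤ := (-1 : ℤ) ^ (p / 2) * p with hd
  set ℓ : ℕ := (primesEquiv v : ℕ) with hℓ
  have hℓp : ℓ.Prime := (primesEquiv v).2
  -- `ℓ ∤ d` and `ℓ ∤ 2`
  have hℓd : ¬ (ℓ : ℤ) ∣ d := by
    rw [hd]
    intro h
    have h' : (ℓ : ℤ) ∣ (p : ℤ) := by
      have hu : IsUnit ((-1 : ℤ) ^ (p / 2)) := (isUnit_neg_one (α := ℤ)).pow _
      exact (hu.dvd_mul_left).mp h
    have := (Nat.prime_dvd_prime_iff_eq hℓp Fact.out).mp (Int.natCast_dvd_natCast.mp h')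
    exact hvp this
  have hℓ2 : ¬ (ℓ : ℤ) ∣ 2 := by
    intro h
    have := (Nat.prime_dvd_prime_iff_eq hℓp Nat.prime_two).mp (Int.natCast_dvd_natCast.mp h)
    exact hv2 this
  have hu := isUnit_adicCompletionIntegers_intCast v hℓd
  have h2 : IsUnit (2 : v.adicCompletionIntegers ℚ) := by
    have := isUnit_adicCompletionIntegers_intCast v hℓ2
    simpa using this
  -- the twist at `v`
  have htw : (W.quadraticTwist (d : ℚ)).baseChange (v.adicCompletion ℚ) =
      (W.baseChange (v.adicCompletion ℚ)).quadraticTwist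
        (algebraMap (v.adicCompletionIntegers ℚ) (v.adicCompletion ℚ) hu.unit) := by
    rw [baseChange, map_quadraticTwist, IsUnit.unit_spec, algebraMap_adicCompletionIntegers_intCast]
    rfl
  rw [htw, localEulerFactor_quadraticTwist (v.adicCompletionIntegers ℚ) h2 _ hu.unit,
    natCard_residueField_adicCompletionIntegers v]
  congr 2
  -- the sign: `d̄` is a square in the residue field iff `(ℓ/p) = 1`
  obtain ⟨e, he⟩ := exists_residueField_ringEquiv_zmod v
  have hsq : IsSquare (residue _ ((hu.unit : (v.adicCompletionIntegers ℚ)ˣ) : v.adicCompletionIntegers ℚ)) ↔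
      IsSquare ((d : ZMod ℓ)) := by
    rw [IsUnit.unit_spec, ← isSquare_ringEquiv_iff e.toMulEquiv, RingEquiv.toMulEquiv_eq_coe,
      RingEquiv.coe_toMulEquiv, he]
  have hd0 : (d : ZMod ℓ) ≠ 0 := by rwa [Ne, ZMod.intCast_zmod_eq_zero_iff_dvd]
  simp only [hsq]
  rw [← legendreSym_pStar hp2 hv2, ← hd]
  congr 1
  split_ifs with h
  · exact ((legendreSym.eq_one_iff ℓ hd0).mpr h).symm
  · exact ((legendreSym.eq_neg_one_iff ℓ).mpr h).symm

/-- Over `ℤ/2` every element satisfies `z² + z = 0`. [folklore] -/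
theorem sq_add_self_eq_zero_of_eq_two {n : ℕ} (hn : n = 2) (z : ZMod n) : z ^ 2 + z = 0 := by
  subst hn
  fin_cases z <;> decide

/-- **The local factor of `E^{(p*)}` at the place over `2`**: with `p* = 1 + 4c` it is the rescaling
by `(2/p)` of that of `E` — the unramified twist at `2`, trivial on the reduction iff `2 ∣ c` iff
`p* ≡ 1 (mod 8)` iff `(2/p) = 1` (`localEulerFactor_quadraticTwist_two`, `eight_dvd_pStar_sub_one_iff`).
[folklore] -/
theorem localEulerFactor_quadraticTwist_pStar_two (hp2 : p ≠ 2) (v : HeightOneSpectrum (𝓞 ℚ))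
    (hv2 : (primesEquiv v : ℕ) = 2) :
    ((W.quadraticTwist (((-1 : ℤ) ^ (p / 2) * p : ℤ) : ℚ)).baseChange (v.adicCompletion ℚ)).localEulerFactor
        (v.adicCompletionIntegers ℚ) =
      ArithmeticFunction.ofPowerSeries (primesEquiv v : ℕ)
        (PowerSeries.rescale (legendreSym p (primesEquiv v : ℕ))
          ((W.baseChange (v.adicCompletion ℚ)).localPowerSeries (v.adicCompletionIntegers ℚ))) := by
  haveI := Fact.mk (primesEquiv v).2
  haveI : NeZero (2 : v.adicCompletion ℚ) := ⟨by
    rw [← map_ofNat (algebraMap ℚ (v.adicCompletion ℚ)) 2]; exact (map_ne_zero _).mpr two_ne_zero⟩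
  haveI : (W.baseChange (v.adicCompletion ℚ)).IsElliptic := by
    change (W.map _).IsElliptic; infer_instance
  set d : ℤ := (-1 : ℤ) ^ (p / 2) * p with hd
  obtain ⟨c, hc⟩ := four_dvd_pStar_sub_one (p := p) hp2
  rw [← hd] at hc
  have hdc : d = 1 + 4 * c := by linear_combination hc
  -- `2 ∈ 𝔪_v`
  have hk : residue _ (2 : v.adicCompletionIntegers ℚ) = 0 := by
    have := residue_adicCompletionIntegers_intCast_eq_zero v (n := 2) (by rw [hv2]; norm_num)
    simpa using this
  -- the twist at `v`
  have htw : (W.quadraticTwist (d : ℚ)).baseChange (v.adicCompletion ℚ) =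
      (W.baseChange (v.adicCompletion ℚ)).quadraticTwist
        (algebraMap (v.adicCompletionIntegers ℚ) (v.adicCompletion ℚ) (1 + 4 * (c : v.adicCompletionIntegers ℚ))) := by
    rw [baseChange, map_quadraticTwist, show (1 + 4 * (c : v.adicCompletionIntegers ℚ)) =
      ((1 + 4 * c : ℤ) : v.adicCompletionIntegers ℚ) by push_cast; ring, ← hdc,
      algebraMap_adicCompletionIntegers_intCast]
    rfl
  rw [htw, localEulerFactor_quadraticTwist_two (v.adicCompletionIntegers ℚ) hk _ (c : v.adicCompletionIntegers ℚ),
    natCard_residueField_adicCompletionIntegers v]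
  congr 2
  -- the sign: `∃ z, z² + z = c̄` iff `2 ∣ c` iff `8 ∣ d - 1` iff `(2/p) = 1`
  obtain ⟨e, he⟩ := exists_residueField_ringEquiv_zmod v
  have hiff : (∃ z : ResidueField (v.adicCompletionIntegers ℚ), z ^ 2 + z = residue _ (c : v.adicCompletionIntegers ℚ)) ↔
      (2 : ℤ) ∣ c := by
    constructor
    · rintro ⟨z, hz⟩
      have h1 : e (residue _ (c : v.adicCompletionIntegers ℚ)) = 0 := by
        rw [← hz, map_add, map_pow]
        exact sq_add_self_eq_zero_of_eq_two hv2 (e z)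
      rw [he] at h1
      have h3 : ((primesEquiv v : ℕ) : ℤ) ∣ c := (ZMod.intCast_zmod_eq_zero_iff_dvd c _).mp h1
      rwa [hv2] at h3
    · intro h2c
      refine ⟨0, ?_⟩
      rw [residue_adicCompletionIntegers_intCast_eq_zero v (by rw [hv2]; exact_mod_cast h2c)]
      ring
  have h8 : (2 : ℤ) ∣ c ↔ (8 : ℤ) ∣ d - 1 := by
    rw [show d - 1 = 4 * c by linear_combination hc]
    omega
  have hp2' : ¬ (p : ℤ) ∣ 2 := fun h ↦
    hp2 ((Nat.prime_dvd_prime_iff_eq Fact.out Nat.prime_two).mp (Int.natCast_dvd_natCast.mp h))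
  simp only [hiff]
  rw [hv2]
  push_cast
  congr 1
  by_cases h2c : (2 : ℤ) ∣ c
  · rw [if_pos h2c]
    exact (((eight_dvd_pStar_sub_one_iff hp2).mp (h8.mp h2c))).symm
  · rw [if_neg h2c]
    rcases legendreSym.eq_one_or_neg_one p (a := 2) (by rwa [Ne, ZMod.intCast_zmod_eq_zero_iff_dvd]) with
      h1 | h1
    · exact absurd (h8.mpr ((eight_dvd_pStar_sub_one_iff hp2).mpr h1)) h2c
    · exact h1.symm

/-! ### The global identity -/

/-- **`aₙ(E^{(p*)}) = (n/p) aₙ(E)` for `p ∤ n`** (`p` an odd prime, `p* = (−1)^{(p−1)/2} p`): the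
Dirichlet coefficients of Mathlib's `L`-function of the quadratic twist by `ℚ(√p*)` are those of `E`
twisted by the Legendre symbol `(·/p)`, away from `p` (Silverman, *AEC* X.2, Exercise 10.16; Knapp,
*Elliptic Curves*, Prop. 12.10, here at all places including the bad ones and `2`). [folklore] -/
theorem LFunction_quadraticTwist_pStar_apply (hp2 : p ≠ 2) {n : ℕ} (hn : ¬ p ∣ n) :
    (W.quadraticTwist (((-1 : ℤ) ^ (p / 2) * p : ℤ) : ℚ)).LFunction n = legendreSym p n * W.LFunction n := by
  set d : ℤ := (-1 : ℤ) ^ (p / 2) * p with hd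
  have hd0 : (d : ℚ) ≠ 0 := by
    rw [hd]
    push_cast
    exact mul_ne_zero (pow_ne_zero _ (by norm_num)) (by exact_mod_cast (Fact.out : p.Prime).ne_zero)
  haveI : (W.quadraticTwist (d : ℚ)).IsElliptic := W.isElliptic_quadraticTwist hd0
  rw [LFunction_eq_eulerProduct, LFunction_eq_eulerProduct]
  refine ArithmeticFunction.eulerProduct_apply_eq_mul_of_forall (P := fun n ↦ ¬ p ∣ n)
    (fun m n h ↦ ⟨fun hm ↦ h (dvd_mul_of_dvd_left hm n), fun hn' ↦ h (dvd_mul_of_dvd_right hn' m)⟩)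
    (fun n : ℕ ↦ legendreSym p n) (by exact_mod_cast legendreSym.at_one p)
    (fun m n ↦ by push_cast; exact legendreSym.mul p m n) _ _ (fun v m hm ↦ ?_)
    (eventually_cofinite_localEulerFactor_apply _) (eventually_cofinite_localEulerFactor_apply _) hn
  haveI := Fact.mk (primesEquiv v).2
  have hℓ1 : 1 < (primesEquiv v : ℕ) := (primesEquiv v).2.one_lt
  by_cases hvp : (primesEquiv v : ℕ) = p
  · -- at `p`: both factors are supported on powers of `p`
    by_cases hm1 : m = 1
    · subst hm1
      rw [localEulerFactor_apply_one, localEulerFactor_apply_one, Nat.cast_one, legendreSym.at_one, one_mul]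
    · have hpow : ¬ ∃ k, Nat.card (ResidueField (v.adicCompletionIntegers ℚ)) ^ k = m := by
        rw [natCard_residueField_adicCompletionIntegers, hvp]
        rintro ⟨k, rfl⟩
        rcases k with _ | k
        · exact hm1 (pow_zero p)
        · exact hm (dvd_pow_self p k.succ_ne_zero)
      rw [localEulerFactor_apply_eq_zero _ _ (by rwa [natCard_residueField_adicCompletionIntegers]) hpow,
        localEulerFactor_apply_eq_zero _ _ (by rwa [natCard_residueField_adicCompletionIntegers]) hpow,
        mul_zero]
  · have key : ((W.quadraticTwist (d : ℚ)).baseChange (v.adicCompletion ℚ)).localEulerFactor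
        (v.adicCompletionIntegers ℚ) =
        ArithmeticFunction.ofPowerSeries (primesEquiv v : ℕ)
          (PowerSeries.rescale (legendreSym p (primesEquiv v : ℕ))
            ((W.baseChange (v.adicCompletion ℚ)).localPowerSeries (v.adicCompletionIntegers ℚ))) := by
      by_cases hv2 : (primesEquiv v : ℕ) = 2
      · exact W.localEulerFactor_quadraticTwist_pStar_two hp2 v hv2
      · exact W.localEulerFactor_quadraticTwist_pStar_of_odd hp2 v hv2 hvp
    rw [key, localEulerFactor, natCard_residueField_adicCompletionIntegers]
    exact ArithmeticFunction.ofPowerSeries_rescale_apply hℓ1 (fun n : ℕ ↦ legendreSym p n)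
      (by exact_mod_cast legendreSym.at_one p) (fun m n ↦ by push_cast; exact legendreSym.mul p m n) _ m

end WeierstrassCurve

end
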